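import Literature.NumberTheory.Sieve.LiouvillePolynomialValuesLevelProofs
import HarnessLib

/-!
# Teräväinen 2024, Prop. 2.11 (quadratic clause): decomposition — the one remaining input

Fact-decomposition file (librarian, mode `fact-decompose`, 2026-08-16) for the named fact
`Literature.NumberTheory.Sieve.teravainen2024_prop_2_11_quadratic` (`LiouvillePolynomialValues.lean`;
J. Teräväinen, Amer. J. Math. 146 (2024) = arXiv:2010.07924, Prop. 2.11, quadratic clause: every
quadratic `P ∈ ℤ[x]` with positive leading coefficient has property S).

The printed proof (§7) is a pointer to the Dartyge–Harman half-dimensional sieve for `n² + 1`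
with "minor modifications". The tree PROVES everything except one input
(`LiouvillePolynomialValuesLevelProofs.lean`, `…SmoothProofs.lean`, `…ReducibleProofs.lean`,
`…TypeIProofs.lean`): reducible quadratics (elementary), the reduction of progressions
`n ≡ b (q)` to the quadratic `P(qX + b)`, and `hasPropertyS_of_level` — property S for an
irreducible quadratic from a level of distribution `x^{1+θ}`, `θ > 0`, of the roots of
`G(ν) ≡ 0 (mod d)` in Iwaniec's bilinear form — assembled as
`PropertyS.teravainen2024_prop_2_11_quadratic_of_level`. For `G = X² + 1` that level (with
`θ = 1/15`) is Iwaniec's Corollary of Proposition 1, PROVED in the tree (`level_X_sq_add_one`,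
from `Iwaniec1978.proposition1_corollary_holds`). For a general irreducible quadratic it is
Lemke Oliver's extension of Iwaniec's dispersion argument (Acta Arith. 151 (2012), Lemma 3 with
Lemma 4 and §3: Hooley's method with the classes of binary quadratic forms of discriminant
`disc G`, Pell units for positive discriminant, Weil's bound), which gives a level `x^{1+γ₀-ε}`
with some `γ₀ = γ₀(G) > 0`; the child below asks for one `θ > 0` serving all `G`, as Lemke
Oliver's `γ₀ = (1-α₀)/(2(1+β₀))` does (his exponents `α₀ = 3/4`, `β₀` are absolute).

* child `lemkeOliver2012_quadraticRoots_level` — the level of distribution beyond `x`, in the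
  tree's normal form (the hypothesis of `teravainen2024_prop_2_11_quadratic_of_level`, verbatim);
* `teravainen2024_prop_2_11_quadratic_holds_of` — the parent from the child (PROVED, one line).

The child does not restate the parent (an equidistribution statement for roots of quadratic
congruences vs. a density statement for smooth values; the parent does not imply it).

## References

* J. Teräväinen, Amer. J. Math. 146 (2024) 1115–1167, Prop. 2.11 and §7. [Teravainen2024]
* R. J. Lemke Oliver, *Almost-primes represented by quadratic polynomials*, Acta Arith. 151
  (2012) 241–261, Lemma 3, Lemma 4, §3. [LemkeOliverActaArith2012]
* H. Iwaniec, *Almost-primes represented by quadratic polynomials*, Invent. Math. 47 (1978)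
  171–188, Proposition 1 and Corollary (p. 176). [IwaniecInventiones1978]
-/

open Finset Real Filter Polynomial
open scoped Classical

noncomputable section

namespace Literature.NumberTheory.Sieve

/-- **Lemke Oliver 2012, Lemma 3 (with Lemma 4, §3) in Iwaniec's normal form: a level of
distribution `x^{1+θ}` for the roots of an irreducible quadratic congruence, bilinear form
(child of `teravainen2024_prop_2_11_quadratic`).** There is `θ > 0` such that for every
`G ∈ ℤ[X]` of degree `2` with positive leading coefficient, irreducible over `ℚ`, and every
`ε > 0` there is `K` with: for `x ≥ 2` and real coefficients `|b_n| ≤ 1` supported on squarefree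
`n`, `∑_{m < x^{1-4ε}} |∑_{n < x^{θ-ε}, (n,m)=1} b_n (|{t ≤ x : mn ∣ G(t)}| - ρ_G(mn) x/(mn))| ≤ K x^{1-ε}`
(`ρ_G(d) = polyRootCountMod ![G] d`, the number of roots of `G` mod `d`). For `G = X² + 1`,
`θ = 1/15`, this is Iwaniec 1978, Corollary of Prop. 1 (p. 176), PROVED in the tree
(`PropertyS.level_X_sq_add_one`); for general `G` it is Lemke Oliver's Lemma 3 (level
`x^{1+γ₀-ε}`, `γ₀ = (1-α₀)/(2(1+β₀)) > 0` from the exponents of his Lemma 4). Verbatim the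
hypothesis of `PropertyS.teravainen2024_prop_2_11_quadratic_of_level`.
[cite: LemkeOliverActaArith2012, Lemma 3 (with Lemma 4, §3)] [cite: IwaniecInventiones1978, Proposition 1 and Corollary (p. 176)] -/
def lemkeOliver2012_quadraticRoots_level : Prop :=
  ∃ θ : ℝ, 0 < θ ∧ ∀ G : ℤ[X], G.natDegree = 2 → 0 < G.leadingCoeff →
    Irreducible (G.map (Int.castRingHom ℚ)) →
    ∀ ε : ℝ, 0 < ε → ∃ K : ℝ, ∀ (x : ℝ) (coef : ℕ → ℝ), 2 ≤ x → (∀ n, |coef n| ≤ 1) →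
      (∀ n, ¬ Squarefree n → coef n = 0) →
      ∑ m ∈ Finset.Ico 1 ⌈x ^ (1 - 4 * ε)⌉₊,
        |∑ n ∈ (Finset.Ico 1 ⌈x ^ (θ - ε)⌉₊).filter (fun n : ℕ => n.Coprime m),
          coef n * (((((Finset.Icc 1 ⌊x⌋₊).filter fun t : ℕ =>
              ((m * n : ℕ) : ℤ) ∣ G.eval (t : ℤ)).card : ℕ) : ℝ) -
            (polyRootCountMod ![G] (m * n) : ℝ) * x / ((m * n : ℕ) : ℝ))| ≤ K * x ^ (1 - ε)

/-- **Assembly (PROVED): Teräväinen's Prop. 2.11 (quadratic clause) from the level of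
distribution** — `PropertyS.teravainen2024_prop_2_11_quadratic_of_level` (reducible quadratics,
progressions via `P(qX + b)`, and `hasPropertyS_of_level`, all proved in the tree).
[cite: Teravainen2024, Proposition 2.11 and §7] -/
theorem teravainen2024_prop_2_11_quadratic_holds_of (h : lemkeOliver2012_quadraticRoots_level) :
    teravainen2024_prop_2_11_quadratic :=
  PropertyS.teravainen2024_prop_2_11_quadratic_of_level h

end Literature.NumberTheory.Sieve

end
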